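import Summits.CriticalPhenomena.PercolationContinuityZ3.Theorems.Transplant.HexShadowGlueEvents
import Summits.CriticalPhenomena.PercolationContinuityZ3.Theorems.Transplant.TriShadowCrossing
import HarnessLib

/-!
# HEXAGONAL SHADOWS XX — Fact 1 of DST §2.3 in hexagonal geometry, I: the crossing step (a path of `B^±` meets a column of `γ_min`) and the closing map `Φ`

builds on p205010 (kernel theorem, internal audit signed; external expert review pending) — NOT used in this file.
Lane `prim-bschramm`, seat `prim-bschramm-p2` (gen 32; class C1b; memo `HOME/bschramm/P2-LATTICES.md` §117); helper file
(`--supports stmt-CriticalPhenomena-4575 --as helper`).  Slab original: `Literature/…/SlabGluingFact1` §"Crossing"/"Closing" — verbatim, with the planar shadow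
replaced by the ×2 subdivision image of the `𝕋`-shadow («TriShadowCrossing»).
* §1 `evC_of_mem_γmin_of_joined/src'`; **`exists_mem_γcols`** — for `ω ∈ 𝒳` (a lattice configuration) and open self-avoiding paths `π⁻ : \overline{src'} → \overline{Y⁻}`,
  `π⁺ : \overline{src'} → \overline{Y⁺}` inside `\overline{small}` (in a sub-configuration), one of them has a vertex on a column of `γ_min(ω)`: else the image
  walks of the shadows of `γ_min` (in `{x₀ ≤ 2(c'₀+2m)}` from `{x₀ ≤ 2(c'₀−2m)}` to the doubled side line) and of `π⁻ ∪ link ∪ π⁺` (in the doubled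
  parallelogram around `small`, between `Y⁻` and `Y⁺`) would be disjoint, contradicting `exists_mem_support_of_side_crossing` and `Seg2.common`;
* §2 **`exists_closed_edge`** (the first vertex `x₁` of such a path on a column of `γ_min`: its column is a point of `U(ω)`, its predecessor `x₀` is joined
  to `\overline{src'}`, `s(x₀,x₁)` is open), the closing map **`phi1 ω = ω ∖ closeSet ω`**, `γmin_phi1` (`γ_min(Φω) = γ_min(ω)`), `U_phi1` (`U(Φω) = U(ω)`),
  **`phi1_not_mem`** (`Φω ∉ B⁻ ∩ B⁺`), `diff_phi1_subset` (the closed edges sit at columns of `U(Φω)`).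
[cite: DuminilCopinSidoraviciusTassion2016, §2.3 (proof of Fact 1, p. 6)]
-/

noncomputable section

namespace Summit.CriticalPhenomena.PercolationContinuityZ3.Theorems.Transplant

open MeasureTheory Literature.Probability.Percolation Literature.Probability.LatticeModels SimpleGraph Filter
open scoped Classical Topology

namespace HexShadow

variable {V : Type} {G : SimpleGraph V} (Φ : HexShadow G) [Countable V]

/-! ## §1 The crossing step -/

/-- `Y⁻ = hexSide c' m (−m) (−a)`. [cite: DuminilCopinSidoraviciusTassion2016, §2.1 (p. 5)] -/
def ym (D : GlueData) : Set (Site 2) := hexSide (Φ.glueCentre D.m D.s) D.m (-(D.m : ℤ)) (-(D.a : ℤ))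

/-- `Y⁺ = hexSide c' m a m`. [cite: DuminilCopinSidoraviciusTassion2016, §2.1 (p. 5)] -/
def yp (D : GlueData) : Set (Site 2) := hexSide (Φ.glueCentre D.m D.s) D.m D.a D.m

omit [Countable V] in
/-- `B⁻` is the crossing `src' ⟷^{small} Y⁻`. [folklore] -/
theorem glueBm_eq (D : GlueData) : Φ.glueBm D.m D.u₁ D.a D.s = Φ.conn (Φ.small D) (Φ.src' D) (Φ.ym D) := rfl

omit [Countable V] in
/-- `B⁺` is the crossing `src' ⟷^{small} Y⁺`. [folklore] -/
theorem glueBp_eq (D : GlueData) : Φ.glueBp D.m D.u₁ D.a D.s = Φ.conn (Φ.small D) (Φ.src' D) (Φ.yp D) := rfl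

/-- A vertex of `γ_min` joined inside `\overline{small}` to `\overline{src'}` gives `C`. [folklore] -/
theorem evC_of_mem_γmin_of_joined (D : GlueData) {ω : BondConfig V} (hA : ω ∈ Φ.glueA D.m D.u₃ D.a D.s) {v : V} (hv : v ∈ Φ.γmin D ω) {s' : V}
    (hs' : s' ∈ Φ.lift (Φ.src' D)) (hj : ω ∈ openConnIn (Φ.lift (Φ.small D)) v s') : ω ∈ Φ.glueC D.m D.u₃ D.u₁ D.s := by
  have hγ := (Φ.γmin_spec D hA).1
  refine ⟨(Φ.γmin D ω).head hγ.ne_nil, hγ.head_mem _, s', hs', ?_⟩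
  exact SlabCriticality.openConnIn_trans (openConnIn_mono (Φ.lift_mono Set.subset_union_left) _ _ (hγ.openConnIn_of_mem hv))
    (openConnIn_mono (Φ.lift_mono Set.subset_union_right) _ _ hj)

/-- A vertex of `γ_min` over `src'` gives `C`. [folklore] -/
theorem evC_of_mem_γmin_of_src' (D : GlueData) {ω : BondConfig V} (hA : ω ∈ Φ.glueA D.m D.u₃ D.a D.s) {v : V} (hv : v ∈ Φ.γmin D ω)
    (hv' : v ∈ Φ.lift (Φ.src' D)) : ω ∈ Φ.glueC D.m D.u₃ D.u₁ D.s := by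
  have hγ := (Φ.γmin_spec D hA).1
  refine ⟨(Φ.γmin D ω).head hγ.ne_nil, hγ.head_mem _, v, hv', ?_⟩
  exact openConnIn_mono (Φ.lift_mono Set.subset_union_left) _ _ (hγ.openConnIn_of_mem hv)

omit [Countable V] in
/-- The shadow of an open path of a lattice configuration is a `triNorm`-1-Lipschitz chain. [folklore] -/
theorem isChain_shadow {ω : BondConfig V} (hω : ω ⊆ G.edgeSet) {l : List V} (hl : l.IsChain (fun a b => s(a, b) ∈ ω ∧ a ≠ b)) :
    l.IsChain (fun u v => triNorm (Φ.sh v - Φ.sh u) ≤ 1) := by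
  refine hl.imp fun a b hab => ?_
  have hadj : G.Adj a b := (SimpleGraph.mem_edgeSet _).1 (hω hab.1)
  have := Φ.lip hadj.symm
  exact this

/-- **THE CROSSING STEP** (DST §2.3, proof of Fact 1: "two paths from `S̄'_n` to `Ȳ_n^-` and `Ȳ_n^+` respectively must intersect at least one set of the form
`\overline{\{z\}}` with `z` in `U(ω)`" — its first half): for `ω ∈ 𝒳` a lattice configuration (data in range) and open self-avoiding paths `π⁻`, `π⁺` from
`\overline{src'}` to `\overline{Y⁻}`, `\overline{Y⁺}` inside `\overline{small}` in a sub-configuration `ω' ⊆ ω`, one of them has a vertex on a column of `γ_min(ω)`.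
[cite: DuminilCopinSidoraviciusTassion2016, §2.3 (proof of Fact 1)] -/
theorem exists_mem_γcols (D : GlueData) (hD : Φ.InRange D) {ω ω' : BondConfig V} (hω : ω ⊆ G.edgeSet) (hω' : ω' ⊆ ω) (hX : ω ∈ Φ.evX D)
    {πm πp : List V} (hπm : OpenSAP ω' (Φ.lift (Φ.small D)) (Φ.lift (Φ.src' D)) (Φ.lift (Φ.ym D)) πm)
    (hπp : OpenSAP ω' (Φ.lift (Φ.small D)) (Φ.lift (Φ.src' D)) (Φ.lift (Φ.yp D)) πp) :
    ∃ x, (x ∈ πm ∨ x ∈ πp) ∧ Φ.sh x ∈ Φ.γcols D ω := by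
  obtain ⟨-, hu₃, hu₁, ha1, ham, -, -⟩ := hD
  obtain ⟨⟨⟨hA, -⟩, -⟩, hC⟩ := hX
  have hγ := (Φ.γmin_spec D hA).1
  obtain ⟨a, lγ, haγ⟩ := List.exists_cons_of_ne_nil hγ.ne_nil
  obtain ⟨am0, lm, ham0⟩ := List.exists_cons_of_ne_nil hπm.ne_nil
  obtain ⟨ap0, lp, hap0⟩ := List.exists_cons_of_ne_nil hπp.ne_nil
  have hγ' : OpenSAP ω (Φ.lift (Φ.big D)) (Φ.lift (Φ.src D)) (Φ.lift (Φ.zSeg D)) (a :: lγ) := haγ ▸ hγ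
  have hπm' := ham0 ▸ hπm
  have hπp' := hap0 ▸ hπp
  by_contra H
  push Not at H
  have hω'E : ω' ⊆ G.edgeSet := hω'.trans hω
  obtain ⟨eγ, Wγ, heγ, hWγ⟩ := exists_dblWalk_of_chain Φ.sh a lγ (Φ.isChain_shadow hω hγ'.chain)
  obtain ⟨em, Wm, hem, hWm⟩ := exists_dblWalk_of_chain Φ.sh am0 lm (Φ.isChain_shadow hω'E hπm'.chain)
  obtain ⟨ep, Wp, hep, hWp⟩ := exists_dblWalk_of_chain Φ.sh ap0 lp (Φ.isChain_shadow hω'E hπp'.chain)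
  -- membership facts
  have hmemγ : ∀ v ∈ a :: lγ, v ∈ Φ.γmin D ω := fun v hv => haγ ▸ hv
  have hmemm : ∀ v ∈ am0 :: lm, v ∈ πm := fun v hv => ham0 ▸ hv
  have hmemp : ∀ v ∈ ap0 :: lp, v ∈ πp := fun v hv => hap0 ▸ hv
  have ha_src : a ∈ Φ.lift (Φ.src D) := hγ'.head_mem (List.cons_ne_nil _ _)
  have heγ_z : eγ ∈ Φ.lift (Φ.zSeg D) := by have := hγ'.last_mem (List.cons_ne_nil _ _); rwa [heγ] at this
  have heγ_mem : eγ ∈ Φ.γmin D ω := hmemγ _ (heγ ▸ List.getLast_mem _)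
  have ham0_src : am0 ∈ Φ.lift (Φ.src' D) := hπm'.head_mem (List.cons_ne_nil _ _)
  have hap0_src : ap0 ∈ Φ.lift (Φ.src' D) := hπp'.head_mem (List.cons_ne_nil _ _)
  have hem_y : em ∈ Φ.lift (Φ.ym D) := by have := hπm'.last_mem (List.cons_ne_nil _ _); rwa [hem] at this
  have hep_y : ep ∈ Φ.lift (Φ.yp D) := by have := hπp'.last_mem (List.cons_ne_nil _ _); rwa [hep] at this
  have hem_mem : em ∈ πm := hmemm _ (hem ▸ List.getLast_mem _)
  have hep_mem : ep ∈ πp := hmemp _ (hep ▸ List.getLast_mem _)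
  -- the link inside `src'` and the walk `Q`
  obtain ⟨Conn, hConn⟩ := exists_dblWalk_in_hexBall (show Φ.sh am0 ∈ hexBall (Φ.glueCentre D.m D.s) D.u₁ from ham0_src)
    (show Φ.sh ap0 ∈ hexBall (Φ.glueCentre D.m D.s) D.u₁ from hap0_src)
  let Q : (zdGraph 2).Walk (dbl (Φ.sh em)) (dbl (Φ.sh ep)) := Wm.reverse.append (Conn.append Wp)
  -- coordinates
  set c' := Φ.glueCentre D.m D.s with hc'def
  have hc'0 : c' 0 = Φ.centre 0 + 4 * D.m := by
    rw [hc'def]; unfold glueCentre; rw [Pi.add_apply, Matrix.cons_val_zero]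
  have hbig : ∀ v ∈ Φ.γmin D ω, Φ.sh v 0 ≤ c' 0 + 2 * D.m := by
    intro v hv
    have h := hγ.subset v hv
    rw [mem_lift, big, mem_hexBall] at h
    have := (abs_le_triNorm (Φ.sh v - Φ.centre)).1
    rw [Pi.sub_apply, abs_le] at this
    push_cast at h; omega
  have hsmall : ∀ z : Site 2, z ∈ Φ.small D → c' 0 - 2 * D.m ≤ z 0 ∧ z 0 ≤ c' 0 + 2 * D.m ∧ c' 1 - 2 * D.m ≤ z 1 ∧ z 1 ≤ c' 1 + 2 * D.m := by
    intro z hz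
    rw [small, mem_hexBall, ← hc'def] at hz
    have h0 := (abs_le_triNorm (z - c')).1
    have h1 := (abs_le_triNorm (z - c')).2
    rw [Pi.sub_apply, abs_le] at h0 h1
    push_cast at hz; omega
  have hsrc'_small : Φ.src' D ⊆ Φ.small D := hexBall_mono _ (by omega)
  -- hypotheses of the planar crossing fact, in doubled coordinates
  have hup0 : ∀ {z z' x : Site 2}, Seg2 z z' x → ∀ {hi : ℤ}, z 0 ≤ hi → z' 0 ≤ hi → x 0 ≤ 2 * hi :=
    fun hs hi h3 h4 => (Seg2.bound₀ hs (min_le_left _ _) (min_le_right _ _) h3 h4).2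
  have hbox : ∀ {z z' x : Site 2}, Seg2 z z' x → z ∈ Φ.small D → z' ∈ Φ.small D →
      2 * (c' 0 - 2 * D.m) ≤ x 0 ∧ x 0 ≤ 2 * (c' 0 + 2 * D.m) ∧ 2 * (c' 1 - 2 * D.m) ≤ x 1 ∧ x 1 ≤ 2 * (c' 1 + 2 * D.m) := by
    intro z z' x hs hz hz'
    obtain ⟨a1, a2, a3, a4⟩ := hsmall z hz
    obtain ⟨b1, b2, b3, b4⟩ := hsmall z' hz'
    have h0 := Seg2.bound₀ hs a1 b1 a2 b2
    have h1 := Seg2.bound₁ hs a3 b3 a4 b4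
    exact ⟨h0.1, h0.2, h1.1, h1.2⟩
  have hγbd : ∀ x ∈ Wγ.support, x 0 ≤ 2 * (c' 0 + 2 * D.m) := by
    intro x hx
    obtain ⟨u, hu, v, hv, hs⟩ := hWγ x hx
    exact hup0 hs (hbig u (hmemγ u hu)) (hbig v (hmemγ v hv))
  have hQsupp : ∀ x ∈ Q.support, (∃ u v, (u ∈ πm ∨ u ∈ πp) ∧ (v ∈ πm ∨ v ∈ πp) ∧ Seg2 (Φ.sh u) (Φ.sh v) x) ∨
      ∃ q ∈ Φ.src' D, ∃ q' ∈ Φ.src' D, Seg2 q q' x := by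
    intro x hx
    rw [Walk.mem_support_append_iff, Walk.mem_support_append_iff, Walk.support_reverse, List.mem_reverse] at hx
    rcases hx with hx | hx | hx
    · obtain ⟨u, hu, v, hv, hs⟩ := hWm x hx
      exact Or.inl ⟨u, v, Or.inl (hmemm u hu), Or.inl (hmemm v hv), hs⟩
    · exact Or.inr (hConn x hx)
    · obtain ⟨u, hu, v, hv, hs⟩ := hWp x hx
      exact Or.inl ⟨u, v, Or.inr (hmemp u hu), Or.inr (hmemp v hv), hs⟩
  have hπsmall : ∀ w, (w ∈ πm ∨ w ∈ πp) → Φ.sh w ∈ Φ.small D := by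
    rintro w (hw | hw)
    · exact hπm.subset w hw
    · exact hπp.subset w hw
  have hQbd : ∀ x ∈ Q.support, 2 * (c' 0 - 2 * D.m) ≤ x 0 ∧ x 0 ≤ 2 * (c' 0 + 2 * D.m) ∧ 2 * (c' 1 - 2 * D.m) ≤ x 1 ∧ x 1 ≤ 2 * (c' 1 + 2 * D.m) := by
    intro x hx
    rcases hQsupp x hx with ⟨u, v, hu, hv, hs⟩ | ⟨q, hq, q', hq', hs⟩
    · exact hbox hs (hπsmall u hu) (hπsmall v hv)
    · exact hbox hs (hsrc'_small hq) (hsrc'_small hq')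
  -- no vertex of `π^±` projects onto a column of `γ_min`, by assumption `H`
  have hoff : ∀ w, (w ∈ πm ∨ w ∈ πp) → ∀ v ∈ Φ.γmin D ω, Φ.sh v ≠ Φ.sh w :=
    fun w hw v hv heq => H w hw ⟨v, hv, heq⟩
  -- the three marked points on the side line `{w₀ = c'₀ + 2m}`
  have heγ' : Φ.sh eγ 0 = c' 0 + 2 * D.m ∧ -(D.a : ℤ) ≤ Φ.sh eγ 1 - c' 1 + D.m ∧ Φ.sh eγ 1 - c' 1 + D.m ≤ D.a := by
    rw [mem_lift, zSeg, mem_hexSide] at heγ_z; exact heγ_z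
  have hem' : Φ.sh em 0 = c' 0 + 2 * D.m ∧ -(D.m : ℤ) ≤ Φ.sh em 1 - c' 1 + D.m ∧ Φ.sh em 1 - c' 1 + D.m ≤ -(D.a : ℤ) := by
    rw [mem_lift, ym, mem_hexSide] at hem_y; exact hem_y
  have hep' : Φ.sh ep 0 = c' 0 + 2 * D.m ∧ (D.a : ℤ) ≤ Φ.sh ep 1 - c' 1 + D.m ∧ Φ.sh ep 1 - c' 1 + D.m ≤ D.m := by
    rw [mem_lift, yp, mem_hexSide] at hep_y; exact hep_y
  have h1 : dbl (Φ.sh em) 1 < dbl (Φ.sh eγ) 1 := by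
    simp only [dbl_apply_one]
    rcases lt_or_eq_of_le (show Φ.sh em 1 ≤ Φ.sh eγ 1 by omega) with h | h
    · omega
    · exact absurd (Site.eq_iff_two.2 ⟨by omega, h.symm⟩) (hoff em (Or.inl hem_mem) eγ heγ_mem)
  have h2 : dbl (Φ.sh eγ) 1 < dbl (Φ.sh ep) 1 := by
    simp only [dbl_apply_one]
    rcases lt_or_eq_of_le (show Φ.sh eγ 1 ≤ Φ.sh ep 1 by omega) with h | h
    · omega
    · exact absurd (Site.eq_iff_two.2 ⟨by omega, h⟩) (hoff ep (Or.inr hep_mem) eγ heγ_mem)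
  have hsa : dbl (Φ.sh a) 0 ≤ 2 * (c' 0 - 2 * D.m) := by
    rw [mem_lift, src, mem_hexBall] at ha_src
    have := (abs_le_triNorm (Φ.sh a - Φ.centre)).1
    rw [Pi.sub_apply, abs_le] at this
    simp only [dbl_apply_zero]
    omega
  obtain ⟨x, hxγ, hxQ⟩ := exists_mem_support_of_side_crossing (L := 2 * (c' 0 - 2 * D.m)) (R := 2 * (c' 0 + 2 * D.m))
    (B := 2 * (c' 1 - 2 * D.m)) (T := 2 * (c' 1 + 2 * D.m)) Wγ Q hγbd hsa (by simp only [dbl_apply_zero]; omega) hQbd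
    (by simp only [dbl_apply_zero]; omega) (by simp only [dbl_apply_zero]; omega) h1 h2
  -- the common image point gives a common shadow point
  obtain ⟨u, hu, v, hv, hsγ⟩ := hWγ x hxγ
  rcases hQsupp x hxQ with ⟨u', v', hu', hv', hs⟩ | ⟨q, hq, q', hq', hs⟩
  · obtain ⟨p, hp1, hp2⟩ := Seg2.common hsγ hs
    have hpγ : ∃ w ∈ Φ.γmin D ω, Φ.sh w = p := by
      rcases hp1 with rfl | rfl
      · exact ⟨u, hmemγ u hu, rfl⟩
      · exact ⟨v, hmemγ v hv, rfl⟩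
    obtain ⟨w, hw, hwp⟩ := hpγ
    rcases hp2 with rfl | rfl
    · exact hoff u' hu' w hw hwp
    · exact hoff v' hv' w hw hwp
  · obtain ⟨p, hp1, hp2⟩ := Seg2.common hsγ hs
    have hpγ : ∃ w ∈ Φ.γmin D ω, Φ.sh w = p := by
      rcases hp1 with rfl | rfl
      · exact ⟨u, hmemγ u hu, rfl⟩
      · exact ⟨v, hmemγ v hv, rfl⟩
    obtain ⟨w, hw, hwp⟩ := hpγ
    have hp_src' : p ∈ Φ.src' D := by
      rcases hp2 with rfl | rfl
      · exact hq
      · exact hq'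
    exact hC (Φ.evC_of_mem_γmin_of_src' D hA hw (by rw [mem_lift, hwp]; exact hp_src'))

/-! ## §2 The first crossing vertex and the closing map `Φ` -/

/-- "`v` is joined to `\overline{src'}` inside `\overline{small}`". [cite: DuminilCopinSidoraviciusTassion2016, §2.3 (proof of Fact 1)] -/
def JoinedSrc' (D : GlueData) (ω : BondConfig V) (v : V) : Prop := ∃ s' ∈ Φ.lift (Φ.src' D), ω ∈ openConnIn (Φ.lift (Φ.small D)) v s'

/-- **The first crossing vertex** (DST §2.3, proof of Fact 1, second half): for `ω ∈ 𝒳` a lattice configuration and an open self-avoiding path `π` from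
`\overline{src'}` inside `\overline{small}` (in a sub-configuration `ω' ⊆ ω`) meeting a column of `γ_min(ω)`, the first vertex `x₁` of `π` on such a column and
its predecessor `x₀`: `s(x₀, x₁)` is `ω'`-open, the column of `x₁` is a point of `U(ω)` (witnessed by the initial segment of `π`), and `x₀` is joined to
`\overline{src'}` inside `\overline{small}`. [cite: DuminilCopinSidoraviciusTassion2016, §2.3 (proof of Fact 1)] -/
theorem exists_closed_edge (D : GlueData) {ω ω' : BondConfig V} (hω : ω ⊆ G.edgeSet) (hω' : ω' ⊆ ω) (hX : ω ∈ Φ.evX D) {Y : Set V} {π : List V}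
    (hπ : OpenSAP ω' (Φ.lift (Φ.small D)) (Φ.lift (Φ.src' D)) Y π) (hmeet : ∃ x ∈ π, Φ.sh x ∈ Φ.γcols D ω) :
    ∃ x₀ x₁, s(x₀, x₁) ∈ ω' ∧ Φ.sh x₁ ∈ Φ.U D ω ∧ Φ.JoinedSrc' D ω x₀ := by
  obtain ⟨⟨⟨hA, -⟩, -⟩, hC⟩ := hX
  obtain ⟨l₁, x₁, l₂, hsplit, hx₁, hl₁⟩ := exists_first_split π hmeet
  -- `l₁` is non-empty: the start of `π` lies over `src'`, and a column of `γ_min` over `src'` would give `C`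
  have hl₁ne : l₁ ≠ [] := by
    rintro rfl
    have hhead : x₁ ∈ Φ.lift (Φ.src' D) := by
      have := hπ.head_mem hπ.ne_nil
      simp only [hsplit, List.nil_append, List.head_cons] at this
      exact this
    obtain ⟨v, hv, hveq⟩ := hx₁
    exact hC (Φ.evC_of_mem_γmin_of_src' D hA hv (by rw [mem_lift, hveq]; exact hhead))
  obtain ⟨b, l₁', hb⟩ := List.exists_cons_of_ne_nil hl₁ne
  set x₀ := l₁.getLast hl₁ne with hx₀
  have hx₀l₁ : x₀ ∈ l₁ := List.getLast_mem hl₁ne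
  have hchain := hπ.chain
  rw [hsplit, List.isChain_append] at hchain
  obtain ⟨hc₁, -, hlink⟩ := hchain
  have hR : s(x₀, x₁) ∈ ω' ∧ x₀ ≠ x₁ :=
    hlink x₀ (by rw [List.getLast?_eq_some_getLast hl₁ne, hx₀]; exact Option.mem_some_iff.2 rfl) x₁ (by simp)
  have hmemπ : ∀ v ∈ l₁, v ∈ π := fun v hv => by rw [hsplit]; exact List.mem_append_left _ hv
  have hx₁π : x₁ ∈ π := by rw [hsplit]; simp
  -- `x₀ x₁` is a lattice edge: the shadows are within `triNorm`-distance `1`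
  have hadj : G.Adj x₀ x₁ := (SimpleGraph.mem_edgeSet _).1 (hω (hω' hR.1))
  have hnear : Φ.sh x₀ ∈ hexBall (Φ.sh x₁) 1 := by
    rw [mem_hexBall, Nat.cast_one]; exact Φ.lip hadj
  -- the initial segment joins `b ∈ \overline{src'}` to `x₀` off the columns of `γ_min`
  have hb_src : b ∈ Φ.lift (Φ.src' D) := by
    have := hπ.head_mem hπ.ne_nil
    simp only [hsplit, hb, List.cons_append, List.head_cons] at this
    exact this
  have hseg : ω' ∈ openConnIn (Φ.lift (Φ.small D) ∩ {v | Φ.sh v ∉ Φ.γcols D ω}) b x₀ := by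
    have hc₁' : (b :: l₁').IsChain (fun a c => s(a, c) ∈ ω' ∧ a ≠ c) := hb ▸ hc₁
    refine openConnIn_head_of_mem_chain b l₁' hc₁' (fun v hv => ?_) x₀ (hb ▸ hx₀l₁)
    have hv' : v ∈ l₁ := hb ▸ hv
    exact ⟨hπ.subset v (hmemπ v hv'), hl₁ v hv'⟩
  have hseg' : ω ∈ openConnIn (Φ.lift (Φ.small D) ∩ {v | Φ.sh v ∉ Φ.γcols D ω}) x₀ b := openConnIn_mono_config hω' (openConnIn_reverse hseg)
  refine ⟨x₀, x₁, hR.1, ⟨hπ.subset x₁ hx₁π, hx₁, x₀, hnear, b, hb_src, hseg'⟩, b, hb_src, openConnIn_mono Set.inter_subset_left _ _ hseg'⟩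

/-- **The set of edges closed by the map of Fact 1**: the open edges `s(u, v)` with `u` on a column of `U(ω)` and `v` joined to `\overline{src'}` inside
`\overline{small}`. [cite: DuminilCopinSidoraviciusTassion2016, §2.3 (proof of Fact 1)] -/
def closeSet (D : GlueData) (ω : BondConfig V) : Set (Sym2 V) := {e | e ∈ ω ∧ ∃ u v, e = s(u, v) ∧ Φ.sh u ∈ Φ.U D ω ∧ Φ.JoinedSrc' D ω v}

/-- **The map `Φ` of Fact 1**: `ω ↦ ω ∖ closeSet ω`. [cite: DuminilCopinSidoraviciusTassion2016, §2.3 (proof of Fact 1, the map Φ)] -/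
def phi1 (D : GlueData) (ω : BondConfig V) : BondConfig V := ω \ Φ.closeSet D ω

/-- `Φ(ω) ⊆ ω`. [folklore] -/
theorem phi1_subset (D : GlueData) (ω : BondConfig V) : Φ.phi1 D ω ⊆ ω := Set.sdiff_subset

/-- On `𝒳`, no edge joining two vertices of `γ_min(ω)` is closed (its endpoint joined to `\overline{src'}` would give `C`).
[cite: DuminilCopinSidoraviciusTassion2016, §2.3 (proof of Fact 1)] -/
theorem not_mem_closeSet_of_mem_γmin (D : GlueData) {ω : BondConfig V} (hX : ω ∈ Φ.evX D) {a b : V} (ha : a ∈ Φ.γmin D ω) (hb : b ∈ Φ.γmin D ω) :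
    s(a, b) ∉ Φ.closeSet D ω := by
  obtain ⟨⟨⟨hA, -⟩, -⟩, hC⟩ := hX
  rintro ⟨-, u, v, heq, -, s', hs', hj⟩
  have hv : v ∈ Φ.γmin D ω := by
    have : v ∈ s(a, b) := by rw [heq]; exact Sym2.mem_mk_right u v
    rcases Sym2.mem_iff.1 this with rfl | rfl
    · exact ha
    · exact hb
  exact hC (Φ.evC_of_mem_γmin_of_joined D hA hv hs' hj)

/-- On `𝒳`, `γ_min(Φ(ω)) = γ_min(ω)`. [cite: DuminilCopinSidoraviciusTassion2016, §2.3 (proof of Fact 1: γ_min(ω') = γ_min(ω))] -/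
theorem γmin_phi1 (D : GlueData) {ω : BondConfig V} (hX : ω ∈ Φ.evX D) : Φ.γmin D (Φ.phi1 D ω) = Φ.γmin D ω := by
  have hA : ω ∈ Φ.glueA D.m D.u₃ D.a D.s := hX.1.1.1
  have hγ := (Φ.γmin_spec D hA).1
  refine minSAP_eq_of_subset (Φ.phi1_subset D ω) (Φ.lift_big_finite D) ((mem_openCrossing_iff_exists_openSAP ω _ _ _).1 hA)
    (hγ.of_edges fun a ha b hb hab => ?_)
  exact ⟨hab, Φ.not_mem_closeSet_of_mem_γmin D hX ha hb⟩

/-- The edges off the columns of `γ_min` are untouched by `Φ`. [folklore] -/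
theorem mem_phi1_iff_of_off (D : GlueData) {ω : BondConfig V} {e : Sym2 V} (he : e ∈ (Φ.lift (Φ.small D) ∩ {v | Φ.sh v ∉ Φ.γcols D ω}).sym2) :
    e ∈ ω ↔ e ∈ Φ.phi1 D ω := by
  refine ⟨fun h => ⟨h, ?_⟩, fun h => h.1⟩
  rintro ⟨-, u, v, rfl, hu, -⟩
  have hu' := (Set.mk_mem_sym2_iff.1 he).1
  exact hu'.2 (Φ.U_subset_γcols D ω hu)

/-- On `𝒳`, `U(Φ(ω)) = U(ω)`. [cite: DuminilCopinSidoraviciusTassion2016, §2.3 (proof of Fact 1: U(ω') = U(ω))] -/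
theorem U_phi1 (D : GlueData) {ω : BondConfig V} (hX : ω ∈ Φ.evX D) : Φ.U D (Φ.phi1 D ω) = Φ.U D ω := by
  have hcols : Φ.γcols D (Φ.phi1 D ω) = Φ.γcols D ω := by simp only [γcols, Φ.γmin_phi1 D hX]
  ext z
  simp only [U, Set.mem_setOf_eq, hcols]
  refine and_congr_right fun _ => and_congr_right fun _ => ?_
  refine exists_congr fun x₀ => and_congr_right fun _ => exists_congr fun s' => and_congr_right fun _ => ?_
  exact (openConnIn_congr (fun e he => Φ.mem_phi1_iff_of_off D he) x₀ s').symm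

/-- **`Φ` blocks `B⁻ ∩ B⁺`** (DST §2.3, proof of Fact 1: "`ω'` cannot contain two open paths in `B̄'_n` from `S̄'_n` to `Ȳ_n^-` and `Ȳ_n^+` respectively"):
for `ω ∈ 𝒳` a lattice configuration, data in range, `Φ(ω) ∉ B⁻ ∩ B⁺`. [cite: DuminilCopinSidoraviciusTassion2016, §2.3 (proof of Fact 1)] -/
theorem phi1_not_mem (D : GlueData) (hD : Φ.InRange D) {ω : BondConfig V} (hω : ω ⊆ G.edgeSet) (hX : ω ∈ Φ.evX D) :
    Φ.phi1 D ω ∉ Φ.glueBm D.m D.u₁ D.a D.s ∩ Φ.glueBp D.m D.u₁ D.a D.s := by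
  rintro ⟨hBm, hBp⟩
  rw [glueBm_eq] at hBm
  rw [glueBp_eq] at hBp
  obtain ⟨πm, hπm⟩ := (mem_openCrossing_iff_exists_openSAP _ _ _ _).1 hBm
  obtain ⟨πp, hπp⟩ := (mem_openCrossing_iff_exists_openSAP _ _ _ _).1 hBp
  obtain ⟨x, hx, hxcol⟩ := Φ.exists_mem_γcols D hD hω (Φ.phi1_subset D ω) hX hπm hπp
  have key : ∀ {Y : Set V} {π : List V}, OpenSAP (Φ.phi1 D ω) (Φ.lift (Φ.small D)) (Φ.lift (Φ.src' D)) Y π →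
      (∃ x ∈ π, Φ.sh x ∈ Φ.γcols D ω) → False := by
    intro Y π hπ hmeet
    obtain ⟨x₀, x₁, hopen, hU, hj⟩ := Φ.exists_closed_edge D hω (Φ.phi1_subset D ω) hX hπ hmeet
    have hclosed : s(x₀, x₁) ∈ Φ.closeSet D ω := ⟨hopen.1, x₁, x₀, Sym2.eq_swap, hU, hj⟩
    exact hopen.2 hclosed
  rcases hx with hx | hx
  · exact key hπm ⟨x, hx, hxcol⟩
  · exact key hπp ⟨x, hx, hxcol⟩

/-- The edges closed by `Φ` sit at the columns of `U(Φ(ω))`. [folklore] -/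
theorem diff_phi1_subset (D : GlueData) {ω : BondConfig V} (hX : ω ∈ Φ.evX D) :
    ω \ Φ.phi1 D ω ⊆ {e | ∃ u ∈ e, Φ.sh u ∈ Φ.U D (Φ.phi1 D ω)} := by
  rintro e ⟨he, hne⟩
  have he' : e ∈ Φ.closeSet D ω := by
    by_contra h
    exact hne ⟨he, h⟩
  obtain ⟨-, u, v, rfl, hu, -⟩ := he'
  exact ⟨u, Sym2.mem_mk_left u v, by rw [Φ.U_phi1 D hX]; exact hu⟩

end HexShadow

end Summit.CriticalPhenomena.PercolationContinuityZ3.Theorems.Transplant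

end
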